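import Literature.AlgebraicGeometry.HodgeTheory.UnitaryTwoOneTimesCMCurveSquareCodimTwo
import HarnessLib

/-!
# The commutant of `End_Hdg(H¹)` is ABELIAN for products: inheritance under `A × B`, a CM elliptic curve, and all its
# powers `E^(n+1)` — the hypothesis `hSc` of the `(2,1) × S` invariance theorem for `S = E³`
# (Moonen–Zarhin 1999 §5 (5.3), (5.12): «`Hg(X₁ᵐ) ≅ Hg(X₁) = U_k` is a torus»; Lange 2023 Cor. 2.4.26)

Family `hodge`, layer `Literature/AlgebraicGeometry/HodgeTheory`. Written for the cell `pub-hodgeav-hg6` (LADDER-HodgeAV row 2,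
TABLE X row 21 `g6.E3xY3.(2,1)` = `E_k³ × Y₃/k (2,1)`, the census programme γ2, brick γ2-A, eng-2 g6; honest framing of that
cell: HC / HC_AV / HC_CM NOT proved — THIS file is unconditional linear algebra on the tree's carriers). UNCONDITIONAL; theorems
only (no definition, no named fact, D-0026; nothing admitted).

WHY. The tree's invariance theorem
`AVSlots.exists_coeff_eq_zero_off_balanced_or_onePerPair_of_prod_unitaryTwoOne_abelianCommutant` (programme R41,
`UnitaryTwoOneTimesCMCurveSquareCodimTwo` §3) treats ONE slot over `T × S`, `T` a `(2,1)`-threefold, for ANY complex abelian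
variety `S` whose `H¹` has an ABELIAN Hodge-commutant (hypothesis `hSc`): R41 supplies `hSc` for `S = E × E`
(`HOneProduct.mul_comm_of_commute_endAlg_cmCurve_prod_self`); the row-21 sixfold `T × E³` needs `S = E³`. This file proves
the commutant statement ONCE for products and iterates it:
* §1 **`HOneProduct.mul_comm_of_forall_commute_endAlg_prod`** — if every two `ℚ`-endomorphisms of `H¹(A)` commuting with
  `End_Hdg(H¹A)` commute, and likewise for `B`, then the same holds for `H¹(A × B)`.  PROOF (Künneth corners): an endomorphism
  `Z` of `H¹(A × B)` commuting with `End_Hdg` commutes with the corner units `pr_A^* e^* ι_A^*`, `e ∈ End⁰(A)` (Hodge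
  endomorphisms: `HOneProduct.unop_bettiRep_inlAlg` + `unop_bettiRep_mem_endAlg`), in particular with the projector
  `pr_A^* ι_A^*`; so `Z = pr_A^* z₁ ι_A^* + pr_B^* z₂ ι_B^*` with `z₁ = ι_A^* Z pr_A^*` commuting with `End_Hdg(H¹A)` — every Hodge
  endomorphism of `H¹(A)` is `e^*` for an `e ∈ End⁰(A)` (fullness, `mem_endAlg_hodge_one_iff_exists_bettiRep`) — and two
  block-diagonal operators commute when their blocks do.
* §2 **`mul_comm_of_forall_commute_endAlg_cmCurve`** — `E` an elliptic curve with `χ ≫ χ = -d'` (`d' > 0`): the commutant of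
  `End_Hdg(H¹E) ∋ χ^*` is commutative (R41's `mul_comm_of_commute_of_mul_self_eq_neg` on the rational plane `H¹(E; ℚ)`).
* §3 **`mul_comm_of_forall_commute_endAlg_cmCurve_powSucc`** — the same for every power `E.powSucc n = E^(n+1)` (induction with
  §1), and **`hSc_cmCurve_powSucc`** — the statement in the exact binder shape `hSc` of the R41 invariance theorem (the
  polarization / skewness binders are not needed and ignored).
NO skewness hypothesis is used anywhere: for these `S` the FULL Hodge-commutant of `H¹(S)` is commutative (it is `k`).

## References
* [MoonenZarhin1999LowDim] B. Moonen, Yu. Zarhin, Math. Ann. 315 (1999), §5 (5.3), (5.12) (arXiv v2 = Math. Ann. numbering: the case (e) analysis «Hg(X) ≅ Hg(X₁ × X₂)», Künneth of H⁴(X₁² × X₂) is item (5.12); earlier tree copies of the R41 family wrote «(5.11)»); §3 Lemma (3.6).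
* [Lange2023AbelianVarietiesC] H. Lange, *Abelian Varieties over the Complex Numbers* (2023), Prop. 1.1.8, Cor. 2.4.26.
* [DeligneMilne1982Tannakian] P. Deligne, J. Milne, LNM 900 (1982), §6 Thm. 6.20 (fullness of `H¹`).
-/

noncomputable section

open scoped TensorProduct
open CategoryTheory Module

namespace Literature.AlgebraicGeometry.HodgeTheory

open Literature.AlgebraicTopology.SingularHomology
open Literature.AlgebraicGeometry.Motives (AbelianVariety bettiCohomology)
open Literature.AlgebraicGeometry.ComplexMultiplication
open Literature.AlgebraicGeometry.Milne1999.CMTypeProducts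

/-! ### §1 Inheritance under products -/

section Prod

variable {A B : AbelianVariety ℂ}

set_option maxHeartbeats 800000 in
/-- **If the Hodge-commutants of `H¹(A)` and of `H¹(B)` are commutative, so is the Hodge-commutant of `H¹(A × B)`.**
For `Z, Z'` commuting with every Hodge endomorphism of `H¹((A × B)(ℂ); ℚ)`: `Z = pr_A^* z₁ ι_A^* + pr_B^* z₂ ι_B^*` with
`z₁ = ι_A^* Z pr_A^*` in the Hodge-commutant of `H¹(A)` (corner units `pr_A^* e^* ι_A^*` are Hodge endomorphisms and
`End_Hdg(H¹A) = End⁰(A)^*`), likewise `z₂`, and block-diagonal operators with commuting blocks commute.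
[cite: Lange2023AbelianVarietiesC, Prop. 1.1.8 and Cor. 2.4.26] [cite: DeligneMilne1982Tannakian, §6 Thm. 6.20]
[cite: MoonenZarhin1999LowDim, §3 Lemma (3.6)] -/
theorem HOneProduct.mul_comm_of_forall_commute_endAlg_prod
    (hA : ∀ z z' : Module.End ℚ (bettiCohomology A.X 1),
      (∀ b : ↥(BettiUniverse.hodge exists_isReal_hodgeModel_holds
        (AbelianVariety.isSmoothProjective_holds (A := A)) 1).endAlg, z * (b : Module.End ℚ _) = (b : Module.End ℚ _) * z) →
      (∀ b : ↥(BettiUniverse.hodge exists_isReal_hodgeModel_holds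
        (AbelianVariety.isSmoothProjective_holds (A := A)) 1).endAlg, z' * (b : Module.End ℚ _) = (b : Module.End ℚ _) * z') →
      z * z' = z' * z)
    (hB : ∀ z z' : Module.End ℚ (bettiCohomology B.X 1),
      (∀ b : ↥(BettiUniverse.hodge exists_isReal_hodgeModel_holds
        (AbelianVariety.isSmoothProjective_holds (A := B)) 1).endAlg, z * (b : Module.End ℚ _) = (b : Module.End ℚ _) * z) →
      (∀ b : ↥(BettiUniverse.hodge exists_isReal_hodgeModel_holds
        (AbelianVariety.isSmoothProjective_holds (A := B)) 1).endAlg, z' * (b : Module.End ℚ _) = (b : Module.End ℚ _) * z') →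
      z * z' = z' * z)
    {Z Z' : Module.End ℚ (bettiCohomology (A.prod B).X 1)}
    (hZ : ∀ b : ↥(BettiUniverse.hodge exists_isReal_hodgeModel_holds
      (AbelianVariety.isSmoothProjective_holds (A := A.prod B)) 1).endAlg,
      Z * (b : Module.End ℚ _) = (b : Module.End ℚ _) * Z)
    (hZ' : ∀ b : ↥(BettiUniverse.hodge exists_isReal_hodgeModel_holds
      (AbelianVariety.isSmoothProjective_holds (A := A.prod B)) 1).endAlg,
      Z' * (b : Module.End ℚ _) = (b : Module.End ℚ _) * Z') :
    Z * Z' = Z' * Z := by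
  have hHD : exists_isReal_hodgeModel := exists_isReal_hodgeModel_holds
  have hI : hodgePQ_independent_of_hodgeModel := hodgePQ_independent_of_hodgeModel_holds
  -- notation: `F = pr_A^*`, `S = pr_B^*`, `I = ι_A^*`, `R = ι_B^*`
  set F := HOneProduct.pullFst A B with hF
  set S := HOneProduct.pullSnd A B with hS
  set I := HOneProduct.pullInl A B with hIdef
  set R := HOneProduct.pullInr A B with hR
  have eIF : ∀ x, I (F x) = x := HOneProduct.pullInl_pullFst
  have eIS : ∀ y, I (S y) = 0 := HOneProduct.pullInl_pullSnd
  have eRS : ∀ y, R (S y) = y := HOneProduct.pullInr_pullSnd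
  have eRF : ∀ x, R (F x) = 0 := HOneProduct.pullInr_pullFst
  have esum : ∀ v, F (I v) + S (R v) = v := HOneProduct.pullFst_pullInl_add
  -- the corner units are Hodge endomorphisms of `H¹(A × B)`
  have hcornerA : ∀ b : Module.End ℚ (bettiCohomology A.X 1),
      b ∈ (BettiUniverse.hodge hHD (AbelianVariety.isSmoothProjective_holds (A := A)) 1).endAlg →
      (F ∘ₗ b ∘ₗ I) ∈ (BettiUniverse.hodge hHD (AbelianVariety.isSmoothProjective_holds (A := A.prod B)) 1).endAlg := by
    intro b hb
    obtain ⟨e, he⟩ := (mem_endAlg_hodge_one_iff_exists_bettiRep hHD hI b).1 hb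
    have h := unop_bettiRep_mem_endAlg hHD hI (inlAlg A B e)
    rwa [HOneProduct.unop_bettiRep_inlAlg, he] at h
  have hcornerB : ∀ b : Module.End ℚ (bettiCohomology B.X 1),
      b ∈ (BettiUniverse.hodge hHD (AbelianVariety.isSmoothProjective_holds (A := B)) 1).endAlg →
      (S ∘ₗ b ∘ₗ R) ∈ (BettiUniverse.hodge hHD (AbelianVariety.isSmoothProjective_holds (A := A.prod B)) 1).endAlg := by
    intro b hb
    obtain ⟨e, he⟩ := (mem_endAlg_hodge_one_iff_exists_bettiRep hHD hI b).1 hb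
    have h := unop_bettiRep_mem_endAlg hHD hI (inrAlg A B e)
    rwa [HOneProduct.unop_bettiRep_inrAlg, he] at h
  -- pointwise commutation with the corner units
  have hcommA : ∀ X : Module.End ℚ (bettiCohomology (A.prod B).X 1),
      (∀ b : ↥(BettiUniverse.hodge hHD (AbelianVariety.isSmoothProjective_holds (A := A.prod B)) 1).endAlg,
        X * (b : Module.End ℚ _) = (b : Module.End ℚ _) * X) →
      ∀ b : Module.End ℚ (bettiCohomology A.X 1),
        b ∈ (BettiUniverse.hodge hHD (AbelianVariety.isSmoothProjective_holds (A := A)) 1).endAlg →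
        ∀ v, X (F (b (I v))) = F (b (I (X v))) := by
    intro X hX b hb v
    have h := congrArg (fun f : Module.End ℚ (bettiCohomology (A.prod B).X 1) => f v) (hX ⟨F ∘ₗ b ∘ₗ I, hcornerA b hb⟩)
    simpa only [Module.End.mul_apply, LinearMap.comp_apply] using h
  have hcommB : ∀ X : Module.End ℚ (bettiCohomology (A.prod B).X 1),
      (∀ b : ↥(BettiUniverse.hodge hHD (AbelianVariety.isSmoothProjective_holds (A := A.prod B)) 1).endAlg,
        X * (b : Module.End ℚ _) = (b : Module.End ℚ _) * X) →
      ∀ b : Module.End ℚ (bettiCohomology B.X 1),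
        b ∈ (BettiUniverse.hodge hHD (AbelianVariety.isSmoothProjective_holds (A := B)) 1).endAlg →
        ∀ v, X (S (b (R v))) = S (b (R (X v))) := by
    intro X hX b hb v
    have h := congrArg (fun f : Module.End ℚ (bettiCohomology (A.prod B).X 1) => f v) (hX ⟨S ∘ₗ b ∘ₗ R, hcornerB b hb⟩)
    simpa only [Module.End.mul_apply, LinearMap.comp_apply] using h
  have h1A : (1 : Module.End ℚ (bettiCohomology A.X 1)) ∈
      (BettiUniverse.hodge hHD (AbelianVariety.isSmoothProjective_holds (A := A)) 1).endAlg := Subalgebra.one_mem _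
  have h1B : (1 : Module.End ℚ (bettiCohomology B.X 1)) ∈
      (BettiUniverse.hodge hHD (AbelianVariety.isSmoothProjective_holds (A := B)) 1).endAlg := Subalgebra.one_mem _
  -- the block form: `X (F x) = F (I X F x)`, `X (S y) = S (R X S y)`
  have hXF : ∀ X : Module.End ℚ (bettiCohomology (A.prod B).X 1),
      (∀ b : ↥(BettiUniverse.hodge hHD (AbelianVariety.isSmoothProjective_holds (A := A.prod B)) 1).endAlg,
        X * (b : Module.End ℚ _) = (b : Module.End ℚ _) * X) →
      ∀ x, X (F x) = F (I (X (F x))) := by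
    intro X hX x
    have h := hcommA X hX 1 h1A (F x)
    rw [Module.End.one_apply, Module.End.one_apply, eIF] at h
    exact h
  have hXS : ∀ X : Module.End ℚ (bettiCohomology (A.prod B).X 1),
      (∀ b : ↥(BettiUniverse.hodge hHD (AbelianVariety.isSmoothProjective_holds (A := A.prod B)) 1).endAlg,
        X * (b : Module.End ℚ _) = (b : Module.End ℚ _) * X) →
      ∀ y, X (S y) = S (R (X (S y))) := by
    intro X hX y
    have h := hcommB X hX 1 h1B (S y)
    rw [Module.End.one_apply, Module.End.one_apply, eRS] at h
    exact h
  -- the blocks commute with the Hodge endomorphisms of the factors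
  have hblockA : ∀ X : Module.End ℚ (bettiCohomology (A.prod B).X 1),
      (∀ b : ↥(BettiUniverse.hodge hHD (AbelianVariety.isSmoothProjective_holds (A := A.prod B)) 1).endAlg,
        X * (b : Module.End ℚ _) = (b : Module.End ℚ _) * X) →
      ∀ b : ↥(BettiUniverse.hodge hHD (AbelianVariety.isSmoothProjective_holds (A := A)) 1).endAlg,
        (I ∘ₗ X ∘ₗ F) * (b : Module.End ℚ _) = (b : Module.End ℚ _) * (I ∘ₗ X ∘ₗ F) := by
    intro X hX b
    refine LinearMap.ext fun x => ?_
    simp only [Module.End.mul_apply, LinearMap.comp_apply]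
    have h := hcommA X hX b b.2 (F x)
    rw [eIF] at h
    rw [h, eIF]
  have hblockB : ∀ X : Module.End ℚ (bettiCohomology (A.prod B).X 1),
      (∀ b : ↥(BettiUniverse.hodge hHD (AbelianVariety.isSmoothProjective_holds (A := A.prod B)) 1).endAlg,
        X * (b : Module.End ℚ _) = (b : Module.End ℚ _) * X) →
      ∀ b : ↥(BettiUniverse.hodge hHD (AbelianVariety.isSmoothProjective_holds (A := B)) 1).endAlg,
        (R ∘ₗ X ∘ₗ S) * (b : Module.End ℚ _) = (b : Module.End ℚ _) * (R ∘ₗ X ∘ₗ S) := by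
    intro X hX b
    refine LinearMap.ext fun y => ?_
    simp only [Module.End.mul_apply, LinearMap.comp_apply]
    have h := hcommB X hX b b.2 (S y)
    rw [eRS] at h
    rw [h, eRS]
  -- the blocks of `Z`, `Z'` commute
  have hAA := hA (I ∘ₗ Z ∘ₗ F) (I ∘ₗ Z' ∘ₗ F) (hblockA Z hZ) (hblockA Z' hZ')
  have hBB := hB (R ∘ₗ Z ∘ₗ S) (R ∘ₗ Z' ∘ₗ S) (hblockB Z hZ) (hblockB Z' hZ')
  have hAAv : ∀ x, I (Z (F (I (Z' (F x))))) = I (Z' (F (I (Z (F x))))) := fun x => by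
    have h := congrArg (fun f : Module.End ℚ (bettiCohomology A.X 1) => f x) hAA
    simpa only [Module.End.mul_apply, LinearMap.comp_apply] using h
  have hBBv : ∀ y, R (Z (S (R (Z' (S y))))) = R (Z' (S (R (Z (S y))))) := fun y => by
    have h := congrArg (fun f : Module.End ℚ (bettiCohomology B.X 1) => f y) hBB
    simpa only [Module.End.mul_apply, LinearMap.comp_apply] using h
  -- expand `Z Z' v` and `Z' Z v` in block form
  have hexp : ∀ X X' : Module.End ℚ (bettiCohomology (A.prod B).X 1),
      (∀ b : ↥(BettiUniverse.hodge hHD (AbelianVariety.isSmoothProjective_holds (A := A.prod B)) 1).endAlg,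
        X * (b : Module.End ℚ _) = (b : Module.End ℚ _) * X) →
      (∀ b : ↥(BettiUniverse.hodge hHD (AbelianVariety.isSmoothProjective_holds (A := A.prod B)) 1).endAlg,
        X' * (b : Module.End ℚ _) = (b : Module.End ℚ _) * X') →
      ∀ v, X (X' v) = F (I (X (F (I (X' (F (I v))))))) + S (R (X (S (R (X' (S (R v))))))) := by
    intro X X' hX hX' v
    conv_lhs => rw [← esum v]
    rw [map_add, hXF X' hX', hXS X' hX', map_add, hXF X hX, hXS X hX]
    simp only [eIF, eRS]
  refine LinearMap.ext fun v => ?_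
  rw [Module.End.mul_apply, Module.End.mul_apply, hexp Z Z' hZ hZ' v, hexp Z' Z hZ' hZ v, hAAv, hBBv]

end Prod

/-! ### §2 A CM elliptic curve -/

section Curve

variable {E : AbelianVariety ℂ}

/-- **The Hodge-commutant of `H¹(E)` is commutative for an elliptic curve with complex multiplication** (`χ ≫ χ = -d'`,
`d' > 0`): the commutant of `χ^* ∈ End_Hdg(H¹E)` on the rational plane `H¹(E(ℂ); ℚ)` is `ℚ + ℚχ^*`
(`mul_comm_of_commute_of_mul_self_eq_neg`). [cite: MoonenZarhin1999LowDim, §2 (2.1) and §5 (5.3)] -/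
theorem mul_comm_of_forall_commute_endAlg_cmCurve (hE1 : E.dim = 1) (χ : E ⟶ E) {d' : ℕ} (hd' : 0 < d')
    (hχ : χ ≫ χ = -(d' • 𝟙 E)) (z z' : Module.End ℚ (bettiCohomology E.X 1))
    (hz : ∀ b : ↥(BettiUniverse.hodge exists_isReal_hodgeModel_holds
      (AbelianVariety.isSmoothProjective_holds (A := E)) 1).endAlg, z * (b : Module.End ℚ _) = (b : Module.End ℚ _) * z)
    (hz' : ∀ b : ↥(BettiUniverse.hodge exists_isReal_hodgeModel_holds
      (AbelianVariety.isSmoothProjective_holds (A := E)) 1).endAlg, z' * (b : Module.End ℚ _) = (b : Module.End ℚ _) * z') :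
    z * z' = z' * z := by
  haveI : Module.Finite ℚ (bettiCohomology E.X 1) := finite_bettiCohomology_one E
  have hW : Module.finrank ℚ (bettiCohomology E.X 1) = 2 := by rw [finrank_bettiCohomology_one E, hE1]
  have hχQ := pullback_mem_endAlg exists_isReal_hodgeModel_holds hodgePQ_independent_of_hodgeModel_holds χ
  exact mul_comm_of_commute_of_mul_self_eq_neg hW (Nat.cast_pos.2 hd') (bettiMapHom_mul_self hχ)
    (hz ⟨_, hχQ⟩) (hz' ⟨_, hχQ⟩)

/-! ### §3 All powers of a CM elliptic curve, and the `hSc` binder shape -/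

/-- **The Hodge-commutant of `H¹(E^(n+1))` is commutative** for an elliptic curve `E` with complex multiplication and
every `n` (`E.powSucc n`; induction: §2 and §1). («`Hg(X₁ᵐ) ≅ Hg(X₁) = U_k` is a torus»; the commutant is `k`.)
[cite: MoonenZarhin1999LowDim, §5 (5.3), (5.12) and §3 Lemma (3.6)] [cite: Lange2023AbelianVarietiesC, Cor. 2.4.26] -/
theorem mul_comm_of_forall_commute_endAlg_cmCurve_powSucc (hE1 : E.dim = 1) (χ : E ⟶ E) {d' : ℕ} (hd' : 0 < d')
    (hχ : χ ≫ χ = -(d' • 𝟙 E)) :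
    ∀ (n : ℕ) (z z' : Module.End ℚ (bettiCohomology (E.powSucc n).X 1)),
      (∀ b : ↥(BettiUniverse.hodge exists_isReal_hodgeModel_holds
        (AbelianVariety.isSmoothProjective_holds (A := E.powSucc n)) 1).endAlg,
        z * (b : Module.End ℚ _) = (b : Module.End ℚ _) * z) →
      (∀ b : ↥(BettiUniverse.hodge exists_isReal_hodgeModel_holds
        (AbelianVariety.isSmoothProjective_holds (A := E.powSucc n)) 1).endAlg,
        z' * (b : Module.End ℚ _) = (b : Module.End ℚ _) * z') →
      z * z' = z' * z
  | 0 => fun z z' hz hz' => mul_comm_of_forall_commute_endAlg_cmCurve hE1 χ hd' hχ z z' hz hz'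
  | n + 1 => fun _ _ hz hz' =>
    HOneProduct.mul_comm_of_forall_commute_endAlg_prod
      (mul_comm_of_forall_commute_endAlg_cmCurve_powSucc hE1 χ hd' hχ n)
      (mul_comm_of_forall_commute_endAlg_cmCurve hE1 χ hd' hχ) hz hz'

/-- **`hSc` for `S = E^(n+1)`** — the binder shape of
`AVSlots.exists_coeff_eq_zero_off_balanced_or_onePerPair_of_prod_unitaryTwoOne_abelianCommutant` (polarization and skewness
binders accepted and unused: the full commutant is commutative). [cite: MoonenZarhin1999LowDim, §5 (5.3), (5.12)] -/
theorem hSc_cmCurve_powSucc (hE1 : E.dim = 1) (χ : E ⟶ E) {d' : ℕ} (hd' : 0 < d') (hχ : χ ≫ χ = -(d' • 𝟙 E)) (n : ℕ) :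
    ∀ (ψ₂ : (BettiUniverse.hodge exists_isReal_hodgeModel_holds
        (AbelianVariety.isSmoothProjective_holds (A := E.powSucc n)) 1).Polarization)
      (Z Z' : Module.End ℚ (bettiCohomology (E.powSucc n).X 1)),
      (∀ b : ↥(BettiUniverse.hodge exists_isReal_hodgeModel_holds
        (AbelianVariety.isSmoothProjective_holds (A := E.powSucc n)) 1).endAlg,
        Z * (b : Module.End ℚ (bettiCohomology (E.powSucc n).X 1)) = (b : Module.End ℚ _) * Z) →
      (∀ v w, ψ₂.form (Z v) w + ψ₂.form v (Z w) = 0) →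
      (∀ b : ↥(BettiUniverse.hodge exists_isReal_hodgeModel_holds
        (AbelianVariety.isSmoothProjective_holds (A := E.powSucc n)) 1).endAlg,
        Z' * (b : Module.End ℚ (bettiCohomology (E.powSucc n).X 1)) = (b : Module.End ℚ _) * Z') →
      (∀ v w, ψ₂.form (Z' v) w + ψ₂.form v (Z' w) = 0) → Z * Z' = Z' * Z :=
  fun _ Z Z' hZ _ hZ' _ => mul_comm_of_forall_commute_endAlg_cmCurve_powSucc hE1 χ hd' hχ n Z Z' hZ hZ'

end Curve

end Literature.AlgebraicGeometry.HodgeTheory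

end
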